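import Mathlib.Analysis.Fourier.FiniteAbelian.PontryaginDuality
import Mathlib.RingTheory.DiscreteValuationRing.Basic
import Literature.NumberTheory.Automorphic.TateLocalFactors
import HarnessLib

/-!
# Additive duality for a non-archimedean local field

Let `F` be a non-archimedean local field and `ψ : F → 𝕊` a non-trivial continuous additive
character. **Additive duality** (Bushnell–Henniart, *The local Langlands conjecture for
`GL(2)`* (2006), §1.7 Proposition; Bump, *Automorphic forms and representations* (1997),
Exercise 3.1.1 (b)–(e), PDF p. 266; Tate's thesis (1950), Lemma 2.2.1 = Cassels–Fröhlich (1967),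
Ch. XV, PDF p. 335): every continuous additive
character `θ` of `F` is of the form `θ(x) = ψ(a x)` for a unique `a ∈ F`, i.e. `a ↦ aψ` is a
group isomorphism `F ≅ F̂`. In Mathlib's language, `θ = ψ.mulShift a` (`AddChar.mulShift`).

This file PROVES this statement (`Literature.NumberTheory.Automorphic.AddCharDuality.exists_eq_mulShift`,
uniqueness `mulShift_injective`), following the printed argument of Bump, Exercise 3.1.1:

1. *No small subgroups* (`Circle.eq_one_of_forall_re_pow_two_pow_pos`): an element of the
   circle all of whose iterated squares have positive real part is `1`; hence a continuous
   additive character is trivial on a ball `{x | v x < γ}` (`exists_forall_lt_apply_eq_one`)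
   and, after a rescaling `x ↦ t x`, trivial on the valuation ring `𝒪[F]`
   (`exists_mulShift_apply_integer_eq_one`); a non-trivial one can be rescaled to have
   *level one*: trivial on `𝓂[F]`, non-trivial on `𝒪[F]` (`exists_mulShift_level_one`,
   Bump (b)).
2. *Finite step* (`exists_apply_eq_apply_mul_of_maximalIdeal`, Bump (c)): if `ψ` has level
   one, every additive character of `𝒪[F]` trivial on `𝓂[F]` is `y ↦ ψ(c y)` for some
   `c ∈ 𝒪[F]`: both descend to the finite residue field `𝓀[F]`, `c̄ ↦ ψ(c ·)` is injective,
   and `#Hom(𝓀, 𝕊) ≤ #𝓀` (Mathlib `AddChar.card_addChar_le`, `AddChar.circleEquivComplex`).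
3. *Successive approximation* (`exists_forall_apply_eq_of_apply_integer_eq_one`, Bump (d)):
   if `θ` is trivial on `𝒪[F]`, one constructs `a_m ∈ 𝒪[F]` with `θ = a_m ψ` on `ϖ^{-m} 𝒪[F]`
   and `a_{m+1} - a_m ∈ 𝓂^{m+1}`; the limit `a` exists by `𝓂`-adic completeness of `𝒪[F]`
   (Mathlib `IsAdicComplete 𝓂[K] 𝒪[K]` for local fields) and `θ = aψ`.

## Mathlib declarations used

`IsNonarchimedeanLocalField` and its consequences `IsDiscreteValuationRing 𝒪[F]`,
`Finite 𝓀[F]`, `IsAdicComplete 𝓂[F] 𝒪[F]`; `IsValuativeTopology.mem_nhds_zero_iff`;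
`IsDiscreteValuationRing.exists_irreducible`, `Irreducible.maximalIdeal_eq`, `Irreducible.coe_ne_zero`,
`Valuation.integer.v_irreducible_lt_one`, `IsDiscreteValuationRing.associated_pow_irreducible`;
`IsLocalRing.residue`;
`AddChar.mulShift`, `AddChar.compAddMonoidHom`, `AddChar.card_addChar_le`,
`AddChar.circleEquivComplex`; `Function.Injective.bijective_of_nat_card_le`;
`IsPrecomplete.prec`, `SModEq.sub_mem`. From H21 (I16): `AddChar.IsContinuousNontrivial`.
Mathlib has the Pontryagin dual as a topological group (`Mathlib/Topology/Algebra/PontryaginDual`)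
and continuous characters of `ℤ_[p]` into `p`-adic algebras (`Mathlib/NumberTheory/Padics/AddChar`),
but no additive self-duality `F ≅ F̂` of a local field (grep `AddChar` in
`Mathlib/NumberTheory/LocalField`, `Mathlib/Topology/Algebra/Valued`: no hits).

## Design notes

* Everything is in `namespace Literature.Automorphic.AddCharDuality` except the circle lemma
  `Literature.NumberTheory.Automorphic.Circle.eq_one_of_forall_re_pow_two_pow_pos`.
* The uniformizer is any irreducible `ϖ : 𝒪[F]` (DVR language), negative powers are written
  `((ϖ : F)⁻¹) ^ m` (no `zpow`).
* Descent to the residue field (`descendResidue`) uses a set-theoretic section of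
  `IsLocalRing.residue` (`Function.surjInv`), avoiding quotient-type bookkeeping.
-/

open ValuativeRel

noncomputable section

namespace Literature.NumberTheory.Automorphic

/-! ### The circle has no small subgroups -/

/-- For `w ∈ 𝕊`: `re (w²) = 2 (re w)² - 1`. [folklore] -/
lemma Circle.re_coe_sq (w : Circle) : ((w ^ 2 : Circle) : ℂ).re = 2 * (w : ℂ).re ^ 2 - 1 := by
  have h := Circle.normSq_coe w
  rw [Complex.normSq_apply] at h
  rw [Circle.coe_pow, sq, Complex.mul_re]
  linear_combination (-1 : ℝ) * h

/-- **The circle group has no small subgroups** (the form used here): if all iterated squares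
`z^(2^k)` of `z ∈ 𝕊` have positive real part, then `z = 1`. Indeed `r_k = re z^(2^k)`
satisfies `r_{k+1} = 2 r_k² - 1 ≤ r_k - (1 - r_0)`, so `r_k → -∞` unless `r_0 = 1`.
(Bump 1997, Exercise 3.1.1 (a), "no small subgroups argument".) [cite: Bump1997, Exercise 3.1.1 (a) (PDF p. 266)] -/
theorem Circle.eq_one_of_forall_re_pow_two_pow_pos (z : Circle)
    (h : ∀ k : ℕ, 0 < ((z ^ (2 ^ k) : Circle) : ℂ).re) : z = 1 := by
  set r : ℕ → ℝ := fun k => ((z ^ (2 ^ k) : Circle) : ℂ).re with hr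
  have hrec : ∀ k, r (k + 1) = 2 * r k ^ 2 - 1 := fun k => by
    simp only [hr, pow_succ, pow_mul]
    exact Circle.re_coe_sq _
  have hr0 : r 0 = (z : ℂ).re := by simp [hr]
  have hpos : ∀ k, 0 < r k := h
  have hle1 : (z : ℂ).re ≤ 1 := by
    have := Complex.abs_re_le_norm (z : ℂ)
    rw [Circle.norm_coe] at this
    exact (abs_le.1 this).2
  have hre : (z : ℂ).re = 1 := by
    by_contra hne
    have hd : 0 < 1 - (z : ℂ).re := sub_pos.2 (lt_of_le_of_ne hle1 hne)
    have key : ∀ k : ℕ, r k ≤ 1 - (k + 1) * (1 - (z : ℂ).re) := by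
      intro k
      induction k with
      | zero => simp [hr0]
      | succ k ih =>
        have hk : 0 < r k := hpos k
        have hk1 : r k ≤ 1 := by
          have := Complex.abs_re_le_norm ((z ^ (2 ^ k) : Circle) : ℂ)
          rw [Circle.norm_coe] at this
          exact (abs_le.1 this).2
        rw [hrec]
        push_cast
        nlinarith [hk, hk1, hd, ih]
    obtain ⟨k, hk⟩ := exists_nat_gt (1 / (1 - (z : ℂ).re))
    have h1 : (1 : ℝ) < (k + 1) * (1 - (z : ℂ).re) := by
      rw [div_lt_iff₀ hd] at hk
      nlinarith
    have := key k
    have := hpos k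
    linarith
  have him : (z : ℂ).im = 0 := by
    have h1 := Circle.normSq_coe z
    rw [Complex.normSq_apply, hre] at h1
    have : (z : ℂ).im * (z : ℂ).im = 0 := by linarith
    exact mul_self_eq_zero.1 this
  apply Circle.ext
  apply Complex.ext <;> simp [hre, him]

namespace AddCharDuality

variable {F : Type*} [Field F] [ValuativeRel F] [TopologicalSpace F]
  [IsNonarchimedeanLocalField F]

/-! ### Continuous characters are trivial near `0` -/

/-- A continuous additive character of a non-archimedean local field is trivial on a ball
`{x | v(x) < γ}` around `0` (the kernel is open: "no small subgroups").
(Bump 1997, Exercise 3.1.1 (a); Bushnell–Henniart 2006, §1.7.) [cite: Bump1997, Exercise 3.1.1 (a) (PDF p. 266)] -/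
theorem exists_forall_lt_apply_eq_one {θ : AddChar F Circle} (hθ : Continuous θ) :
    ∃ γ : (ValueGroupWithZero F)ˣ, ∀ x : F, valuation F x < γ → θ x = 1 := by
  set W : Set Circle := {w | 0 < (w : ℂ).re} with hW_def
  have hW : IsOpen W :=
    isOpen_lt continuous_const (Complex.continuous_re.comp continuous_subtype_val)
  have h1 : θ 0 ∈ W := by simp [W]
  have hmem : θ ⁻¹' W ∈ nhds (0 : F) := hθ.continuousAt.preimage_mem_nhds (hW.mem_nhds h1)
  obtain ⟨γ, hγ⟩ := (IsValuativeTopology.mem_nhds_zero_iff _).1 hmem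
  refine ⟨γ, fun x hx => Circle.eq_one_of_forall_re_pow_two_pow_pos _ fun k => ?_⟩
  have hball : ∀ n : ℕ, valuation F (n • x) < γ := by
    intro n
    induction n with
    | zero => simp
    | succ n ih =>
      rw [succ_nsmul]
      exact (Valuation.map_add _ _ _).trans_lt (max_lt ih hx)
  have := hγ (hball (2 ^ k))
  rw [Set.mem_preimage, AddChar.map_nsmul_eq_pow] at this
  simpa [W] using this

variable {ϖ : 𝒪[F]}

/-- An irreducible element (uniformizer) `ϖ` lies in `𝓂[F]`. [folklore] -/
lemma mem_maximalIdeal_of_irreducible (hϖ : Irreducible ϖ) : ϖ ∈ 𝓂[F] := by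
  rw [hϖ.maximalIdeal_eq]
  exact Ideal.mem_span_singleton_self ϖ

/-- Every `x ∈ F` lies in `ϖ^{-n} 𝒪[F]` for some `n`: `ϖ^n x ∈ 𝒪[F]` (`F` is the fraction
field of the discrete valuation ring `𝒪[F]`). [folklore] -/
theorem exists_pow_mul_eq_coe (hϖ : Irreducible ϖ) (x : F) :
    ∃ n : ℕ, ∃ y : 𝒪[F], (ϖ : F) ^ n * x = y := by
  by_cases hx : valuation F x ≤ 1
  · exact ⟨0, ⟨x, (Valuation.mem_integer_iff _ _).2 hx⟩, by simp⟩
  · have hx0 : x ≠ 0 := by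
      rintro rfl
      simp at hx
    have hxi : valuation F x⁻¹ ≤ 1 := by
      rw [map_inv₀]
      exact inv_le_one_of_one_le₀ (le_of_not_ge hx)
    set z : 𝒪[F] := ⟨x⁻¹, (Valuation.mem_integer_iff _ _).2 hxi⟩ with hz_def
    have hz : z ≠ 0 := by
      intro h
      have : (z : F) = 0 := by rw [h]; rfl
      exact inv_ne_zero hx0 this
    obtain ⟨n, u, hu⟩ := IsDiscreteValuationRing.associated_pow_irreducible hz hϖ
    refine ⟨n, (u : 𝒪[F]), ?_⟩
    have := congrArg Subtype.val hu
    simp only [Subring.coe_mul, SubmonoidClass.coe_pow] at this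
    -- this : x⁻¹ * ↑↑u = ↑ϖ ^ n
    rw [← this, mul_comm, ← mul_assoc, mul_inv_cancel₀ hx0, one_mul]

/-- After rescaling, a continuous additive character is trivial on `𝒪[F]`: there is `t ≠ 0`
with `θ(t y) = 1` for all `y ∈ 𝒪[F]`. (Bump 1997, Exercise 3.1.1 (a)–(b).) [cite: Bump1997, Exercise 3.1.1 (a)-(b) (PDF p. 266)] -/
theorem exists_mulShift_apply_integer_eq_one (hϖ : Irreducible ϖ) {θ : AddChar F Circle}
    (hθ : Continuous θ) :
    ∃ t : F, t ≠ 0 ∧ ∀ y : 𝒪[F], θ.mulShift t y = 1 := by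
  obtain ⟨γ, hγ⟩ := exists_forall_lt_apply_eq_one hθ
  obtain ⟨g, hg⟩ := ValuativeRel.valuation_surjective (γ : ValueGroupWithZero F)
  have hg0 : g ≠ 0 := by
    rintro rfl
    exact γ.ne_zero (by simpa using hg.symm)
  refine ⟨g * ϖ, mul_ne_zero hg0 (hϖ.coe_ne_zero), fun y => ?_⟩
  rw [AddChar.mulShift_apply]
  apply hγ
  rw [map_mul, map_mul, hg, mul_assoc]
  refine mul_lt_of_lt_one_right (zero_lt_iff.2 γ.ne_zero) ?_
  exact mul_lt_one_of_lt_of_le (Valuation.integer.v_irreducible_lt_one hϖ) y.2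

/-- **Level normalisation** (Bump 1997, Exercise 3.1.1 (b); Bushnell–Henniart 2006, §1.7,
level of a character): a non-trivial continuous `ψ` can be rescaled to have level one, i.e.
`ψ(t ·)` is trivial on `𝓂[F]` but not on `𝒪[F]`, for some `t ≠ 0`. [cite: Bump1997, Exercise 3.1.1 (b) (PDF p. 266)] -/
theorem exists_mulShift_level_one (hϖ : Irreducible ϖ) {ψ : AddChar F Circle}
    (hψ : ψ.IsContinuousNontrivial) :
    ∃ t : F, t ≠ 0 ∧ (∀ y : 𝒪[F], y ∈ 𝓂[F] → ψ.mulShift t y = 1) ∧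
      ∃ y : 𝒪[F], ψ.mulShift t y ≠ 1 := by
  classical
  have hϖ0 := hϖ.coe_ne_zero
  obtain ⟨t₀, ht₀, h0⟩ := exists_mulShift_apply_integer_eq_one hϖ hψ.1
  simp only [AddChar.mulShift_apply] at h0
  obtain ⟨x₀, hx₀⟩ := AddChar.ne_zero_iff.1 hψ.2
  have hQ : ∃ M : ℕ, ∃ y : 𝒪[F], ψ (t₀ * (((ϖ : F)⁻¹) ^ M * y)) ≠ 1 := by
    obtain ⟨n, y, hy⟩ := exists_pow_mul_eq_coe hϖ (t₀⁻¹ * x₀)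
    refine ⟨n, y, ?_⟩
    have : t₀ * (((ϖ : F)⁻¹) ^ n * y) = x₀ := by
      rw [← hy, inv_pow, ← mul_assoc ((ϖ : F) ^ n)⁻¹, inv_mul_cancel₀ (pow_ne_zero _ hϖ0),
        one_mul, mul_inv_cancel_left₀ ht₀]
    rwa [this]
  set M := Nat.find hQ with hM_def
  have hM : ∃ y : 𝒪[F], ψ (t₀ * (((ϖ : F)⁻¹) ^ M * y)) ≠ 1 := Nat.find_spec hQ
  have hM0 : M ≠ 0 := by
    intro hM0
    obtain ⟨y, hy⟩ := hM
    rw [hM0, pow_zero, one_mul] at hy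
    exact hy (h0 y)
  obtain ⟨M', hM'⟩ := Nat.exists_eq_succ_of_ne_zero hM0
  have hlt : ¬ ∃ y : 𝒪[F], ψ (t₀ * (((ϖ : F)⁻¹) ^ M' * y)) ≠ 1 :=
    Nat.find_min hQ (by rw [← hM_def, hM']; exact Nat.lt_succ_self M')
  push Not at hlt
  refine ⟨t₀ * ((ϖ : F)⁻¹) ^ M, mul_ne_zero ht₀ (pow_ne_zero _ (inv_ne_zero hϖ0)),
    fun y hy => ?_, ?_⟩
  · rw [hϖ.maximalIdeal_eq, Ideal.mem_span_singleton] at hy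
    obtain ⟨y', rfl⟩ := hy
    rw [AddChar.mulShift_apply, hM', Subring.coe_mul, mul_assoc]
    have : ((ϖ : F)⁻¹) ^ (M' + 1) * ((ϖ : F) * y') = ((ϖ : F)⁻¹) ^ M' * y' := by
      rw [pow_succ, mul_assoc, inv_mul_cancel_left₀ hϖ0]
    rw [this]
    exact hlt y'
  · obtain ⟨y, hy⟩ := hM
    exact ⟨y, by rwa [AddChar.mulShift_apply, mul_assoc]⟩

/-! ### Descent to the residue field and the finite step -/

/-- Descend an additive character of `𝒪[F]` that is trivial on `𝓂[F]` to the residue field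
`𝓀[F]` (via a set-theoretic section of `IsLocalRing.residue`). [folklore] -/
def descendResidue (l : AddChar 𝒪[F] Circle) (hl : ∀ y ∈ 𝓂[F], l y = 1) :
    AddChar 𝓀[F] Circle where
  toFun ξ := l (Function.surjInv (IsLocalRing.residue_surjective (R := 𝒪[F])) ξ)
  map_zero_eq_one' := by
    apply hl
    rw [← IsLocalRing.residue_eq_zero_iff]
    exact Function.surjInv_eq (IsLocalRing.residue_surjective (R := 𝒪[F])) 0
  map_add_eq_mul' a b := by
    have hs : ∀ ξ, IsLocalRing.residue 𝒪[F]
        (Function.surjInv (IsLocalRing.residue_surjective (R := 𝒪[F])) ξ) = ξ :=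
      Function.surjInv_eq _
    have hmem : Function.surjInv (IsLocalRing.residue_surjective (R := 𝒪[F])) (a + b) -
        (Function.surjInv (IsLocalRing.residue_surjective (R := 𝒪[F])) a +
          Function.surjInv (IsLocalRing.residue_surjective (R := 𝒪[F])) b) ∈ 𝓂[F] := by
      rw [← IsLocalRing.residue_eq_zero_iff, map_sub, map_add, hs, hs, hs, sub_self]
    have := hl _ hmem
    rwa [AddChar.map_sub_eq_div, div_eq_one, AddChar.map_add_eq_mul] at this

/-- `descendResidue l` evaluated at the residue class of `y` is `l y`. [folklore] -/
lemma descendResidue_apply_residue (l : AddChar 𝒪[F] Circle) (hl : ∀ y ∈ 𝓂[F], l y = 1)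
    (y : 𝒪[F]) : descendResidue l hl (IsLocalRing.residue 𝒪[F] y) = l y := by
  change l (Function.surjInv _ (IsLocalRing.residue _ y)) = l y
  have hs : ∀ ξ, IsLocalRing.residue 𝒪[F]
      (Function.surjInv (IsLocalRing.residue_surjective (R := 𝒪[F])) ξ) = ξ :=
    Function.surjInv_eq _
  have hmem : Function.surjInv (IsLocalRing.residue_surjective (R := 𝒪[F]))
      (IsLocalRing.residue 𝒪[F] y) - y ∈ 𝓂[F] := by
    rw [← IsLocalRing.residue_eq_zero_iff, map_sub, hs, sub_self]
  have := hl _ hmem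
  rwa [AddChar.map_sub_eq_div, div_eq_one] at this

/-- The restriction of an additive character of `F` to `𝒪[F]`. [folklore] -/
def restrictInteger (χ : AddChar F Circle) : AddChar 𝒪[F] Circle :=
  χ.compAddMonoidHom (𝒪[F].subtype : 𝒪[F] →+* F).toAddMonoidHom

omit [TopologicalSpace F] [IsNonarchimedeanLocalField F] in
/-- `restrictInteger χ y = χ y`. [folklore] -/
@[simp] lemma restrictInteger_apply (χ : AddChar F Circle) (y : 𝒪[F]) :
    restrictInteger χ y = χ y := rfl

/-- **Finite step** (Bump 1997, Exercise 3.1.1 (c): additive duality for the finite residue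
field): if `ψ` is trivial on `𝓂[F]` but not on `𝒪[F]`, then every additive character `l` of
`𝒪[F]` trivial on `𝓂[F]` is `y ↦ ψ(c y)` for some `c ∈ 𝒪[F]`. Proof: `c̄ ↦ ψ(c ·)` is an
injective map from `𝓀[F]` to the additive characters of `𝓀[F]`, hence bijective since
`#Hom(𝓀, 𝕊) ≤ #𝓀`. [cite: Bump1997, Exercise 3.1.1 (c) (PDF p. 266)] -/
theorem exists_apply_eq_apply_mul_of_maximalIdeal {ψ : AddChar F Circle}
    (hψ1 : ∀ y : 𝒪[F], y ∈ 𝓂[F] → ψ y = 1) (hψ2 : ∃ y : 𝒪[F], ψ y ≠ 1)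
    (l : AddChar 𝒪[F] Circle) (hl : ∀ y ∈ 𝓂[F], l y = 1) :
    ∃ c : 𝒪[F], ∀ y : 𝒪[F], l y = ψ (c * y) := by
  classical
  set s := Function.surjInv (IsLocalRing.residue_surjective (R := 𝒪[F])) with hs_def
  have hs : ∀ ξ, IsLocalRing.residue 𝒪[F] (s ξ) = ξ := Function.surjInv_eq _
  have hψO : ∀ c y : 𝒪[F], ((restrictInteger ψ).mulShift c) y = ψ (c * y) := fun c y => rfl
  have hκ : ∀ c : 𝒪[F], ∀ y ∈ 𝓂[F], (restrictInteger ψ).mulShift c y = 1 := fun c y hy => by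
    rw [hψO]
    exact hψ1 _ (Ideal.mul_mem_left _ c hy)
  let κ : 𝓀[F] → AddChar 𝓀[F] Circle := fun ξ =>
    descendResidue ((restrictInteger ψ).mulShift (s ξ)) (hκ _)
  have hκ_apply : ∀ ξ (y : 𝒪[F]), κ ξ (IsLocalRing.residue 𝒪[F] y) = ψ (s ξ * y) :=
    fun ξ y => by
      simp only [κ, descendResidue_apply_residue, hψO]
  have hinj : Function.Injective κ := by
    intro ξ₁ ξ₂ h
    have hy : ∀ y : 𝒪[F], ψ (((s ξ₁ - s ξ₂) * y : 𝒪[F]) : F) = 1 := by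
      intro y
      have h' := DFunLike.congr_fun h (IsLocalRing.residue _ y)
      rw [hκ_apply, hκ_apply] at h'
      push_cast
      rw [sub_mul, AddChar.map_sub_eq_div, h', div_self']
    by_contra hne
    have hunit : IsUnit (s ξ₁ - s ξ₂) := by
      rw [← IsLocalRing.residue_ne_zero_iff_isUnit, map_sub, hs, hs, sub_ne_zero]
      exact hne
    obtain ⟨y0, hy0⟩ := hψ2
    apply hy0
    obtain ⟨u, hu⟩ := hunit
    have := hy (↑u⁻¹ * y0)
    rwa [← hu, Units.mul_inv_cancel_left] at this
  haveI : Finite (AddChar 𝓀[F] Circle) :=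
    Finite.of_equiv _ (AddChar.circleEquivComplex (α := 𝓀[F])).toEquiv.symm
  have hcard : Nat.card (AddChar 𝓀[F] Circle) ≤ Nat.card 𝓀[F] := by
    letI := Fintype.ofFinite 𝓀[F]
    rw [Nat.card_congr (AddChar.circleEquivComplex (α := 𝓀[F])).toEquiv,
      Nat.card_eq_fintype_card, Nat.card_eq_fintype_card]
    exact AddChar.card_addChar_le _ _
  have hbij := hinj.bijective_of_nat_card_le hcard
  obtain ⟨ξ, hξ⟩ := hbij.2 (descendResidue l hl)
  refine ⟨s ξ, fun y => ?_⟩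
  have := DFunLike.congr_fun hξ (IsLocalRing.residue _ y)
  rw [hκ_apply, descendResidue_apply_residue] at this
  exact this.symm

/-! ### Successive approximation -/

/-- The induction invariant: `θ(ϖ^{-m} y) = ψ(a ϖ^{-m} y)` for all `y ∈ 𝒪[F]`, i.e.
`θ = aψ` on `𝔭^{-m}`. [folklore] -/
def Approximates (ψ θ : AddChar F Circle) (ϖ : 𝒪[F]) (m : ℕ) (a : 𝒪[F]) : Prop :=
  ∀ y : 𝒪[F], θ (((ϖ : F)⁻¹) ^ m * y) = ψ (a * (((ϖ : F)⁻¹) ^ m * y))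

/-- **Induction step** (Bump 1997, Exercise 3.1.1 (d), hint): if `θ = a ψ` on `𝔭^{-m}` then
`θ = (a + c ϖ^{m+1}) ψ` on `𝔭^{-m-1}` for some `c ∈ 𝒪[F]` (apply the finite step to
`x ↦ θ(ϖ^{-m-1} x) ψ(-a ϖ^{-m-1} x)` on `𝒪[F]`). [cite: Bump1997, Exercise 3.1.1 (d) (PDF p. 266)] -/
theorem Approximates.step (hϖ : Irreducible ϖ) {ψ θ : AddChar F Circle}
    (hψ1 : ∀ y : 𝒪[F], y ∈ 𝓂[F] → ψ y = 1) (hψ2 : ∃ y : 𝒪[F], ψ y ≠ 1)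
    {m : ℕ} {a : 𝒪[F]} (h : Approximates ψ θ ϖ m a) :
    ∃ c : 𝒪[F], Approximates ψ θ ϖ (m + 1) (a + c * ϖ ^ (m + 1)) := by
  have hϖ0 := hϖ.coe_ne_zero
  set t : F := ((ϖ : F)⁻¹) ^ (m + 1) with ht
  let χ : AddChar F Circle := θ.mulShift t * (ψ.mulShift (a * t))⁻¹
  have hχ : ∀ x, χ x = θ (t * x) / ψ (a * (t * x)) := by
    intro x
    simp only [χ, AddChar.mul_apply, AddChar.inv_apply', AddChar.mulShift_apply, mul_assoc,
      div_eq_mul_inv]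
  have hχO : ∀ y ∈ 𝓂[F], restrictInteger χ y = 1 := by
    intro y hy
    rw [hϖ.maximalIdeal_eq, Ideal.mem_span_singleton] at hy
    obtain ⟨y', rfl⟩ := hy
    rw [restrictInteger_apply, hχ, Subring.coe_mul]
    have : t * ((ϖ : F) * y') = ((ϖ : F)⁻¹) ^ m * y' := by
      rw [ht, pow_succ, mul_assoc, inv_mul_cancel_left₀ hϖ0]
    rw [this, h y', div_self']
  obtain ⟨c, hc⟩ := exists_apply_eq_apply_mul_of_maximalIdeal hψ1 hψ2 _ hχO
  refine ⟨c, fun y => ?_⟩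
  have h1 : θ (t * y) = ψ (c * y) * ψ (a * (t * y)) := by
    have := hc y
    rw [restrictInteger_apply, hχ, div_eq_iff_eq_mul] at this
    exact this
  change θ (t * y) = ψ (↑(a + c * ϖ ^ (m + 1)) * (t * y))
  rw [h1, ← AddChar.map_add_eq_mul]
  congr 1
  have htϖ : (ϖ : F) ^ (m + 1) * t = 1 := by
    rw [ht, inv_pow, mul_inv_cancel₀ (pow_ne_zero _ hϖ0)]
  push_cast
  linear_combination (-(c : F) * y) * htϖ

/-- The approximating sequence `a_m` of Bump 1997, Exercise 3.1.1 (d): `a_0 = 0`,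
`a_{m+1} = a_m + c_m ϖ^{m+1}` with `θ = a_m ψ` on `𝔭^{-m}` (for `θ` trivial on `𝒪[F]`). [cite: Bump1997, Exercise 3.1.1 (d) (PDF p. 266)] -/
def approxSeq (hϖ : Irreducible ϖ) {ψ θ : AddChar F Circle}
    (hψ1 : ∀ y : 𝒪[F], y ∈ 𝓂[F] → ψ y = 1) (hψ2 : ∃ y : 𝒪[F], ψ y ≠ 1)
    (hθ : ∀ y : 𝒪[F], θ y = 1) : (m : ℕ) → {a : 𝒪[F] // Approximates ψ θ ϖ m a}
  | 0 => ⟨0, fun y => by simp [hθ y]⟩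
  | m + 1 =>
    ⟨(approxSeq hϖ hψ1 hψ2 hθ m).1 +
        Classical.choose ((approxSeq hϖ hψ1 hψ2 hθ m).2.step hϖ hψ1 hψ2) * ϖ ^ (m + 1),
      Classical.choose_spec ((approxSeq hϖ hψ1 hψ2 hθ m).2.step hϖ hψ1 hψ2)⟩

/-- Consecutive terms of the approximating sequence differ by an element of `𝓂^{m+1}`:
`a_{m+1} - a_m = c_m ϖ^{m+1}`. (Bump 1997, Exercise 3.1.1 (d), hint.) [cite: Bump1997, Exercise 3.1.1 (d) (PDF p. 266)] -/
lemma approxSeq_succ_sub_mem (hϖ : Irreducible ϖ) {ψ θ : AddChar F Circle}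
    (hψ1 : ∀ y : 𝒪[F], y ∈ 𝓂[F] → ψ y = 1) (hψ2 : ∃ y : 𝒪[F], ψ y ≠ 1)
    (hθ : ∀ y : 𝒪[F], θ y = 1) (m : ℕ) :
    (approxSeq hϖ hψ1 hψ2 hθ (m + 1)).1 - (approxSeq hϖ hψ1 hψ2 hθ m).1 ∈ 𝓂[F] ^ (m + 1) := by
  change (approxSeq hϖ hψ1 hψ2 hθ m).1 + _ * ϖ ^ (m + 1) - _ ∈ _
  rw [add_sub_cancel_left]
  exact Ideal.mul_mem_left _ _ (Ideal.pow_mem_pow (mem_maximalIdeal_of_irreducible hϖ) _)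

/-- The approximating sequence is `𝓂`-adically Cauchy: `a_m - a_n ∈ 𝓂^m` for `m ≤ n`.
(Bump 1997, Exercise 3.1.1 (d): "Show that `{a_N}` is a Cauchy sequence".) [cite: Bump1997, Exercise 3.1.1 (d) (PDF p. 266)] -/
lemma approxSeq_sub_mem (hϖ : Irreducible ϖ) {ψ θ : AddChar F Circle}
    (hψ1 : ∀ y : 𝒪[F], y ∈ 𝓂[F] → ψ y = 1) (hψ2 : ∃ y : 𝒪[F], ψ y ≠ 1)
    (hθ : ∀ y : 𝒪[F], θ y = 1) {m n : ℕ} (hmn : m ≤ n) :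
    (approxSeq hϖ hψ1 hψ2 hθ m).1 - (approxSeq hϖ hψ1 hψ2 hθ n).1 ∈ 𝓂[F] ^ m := by
  induction n, hmn using Nat.le_induction with
  | base => simp
  | succ n hmn ih =>
    have h := approxSeq_succ_sub_mem hϖ hψ1 hψ2 hθ n
    have h' : (approxSeq hϖ hψ1 hψ2 hθ (n + 1)).1 - (approxSeq hϖ hψ1 hψ2 hθ n).1 ∈ 𝓂[F] ^ m :=
      Ideal.pow_le_pow_right (by omega) h
    have := sub_mem ih h'
    rwa [sub_sub_sub_cancel_right] at this

/-- **Successive approximation** (Bump 1997, Exercise 3.1.1 (d)): if `ψ` has level one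
(trivial on `𝓂[F]`, not on `𝒪[F]`) and `θ` is trivial on `𝒪[F]`, then `θ = aψ` for some
`a ∈ 𝒪[F]`; `a = lim a_m` exists by the `𝓂`-adic completeness of `𝒪[F]`. [cite: Bump1997, Exercise 3.1.1 (d) (PDF p. 266)] -/
theorem exists_forall_apply_eq_of_apply_integer_eq_one (hϖ : Irreducible ϖ)
    {ψ θ : AddChar F Circle}
    (hψ1 : ∀ y : 𝒪[F], y ∈ 𝓂[F] → ψ y = 1) (hψ2 : ∃ y : 𝒪[F], ψ y ≠ 1)
    (hθ : ∀ y : 𝒪[F], θ y = 1) : ∃ a : 𝒪[F], ∀ x : F, θ x = ψ (a * x) := by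
  have hϖ0 := hϖ.coe_ne_zero
  letI := IsTopologicalAddGroup.rightUniformSpace F
  haveI := isUniformAddGroup_of_addCommGroup (G := F)
  have hprec : IsPrecomplete 𝓂[F] 𝒪[F] := inferInstance
  set f : ℕ → 𝒪[F] := fun m => (approxSeq hϖ hψ1 hψ2 hθ m).1 with hf
  have hcauchy : ∀ {m n}, m ≤ n →
      f m ≡ f n [SMOD (𝓂[F] ^ m • ⊤ : Submodule 𝒪[F] 𝒪[F])] := by
    intro m n hmn
    simp only [SModEq.sub_mem, smul_eq_mul, Ideal.mul_top]
    exact approxSeq_sub_mem hϖ hψ1 hψ2 hθ hmn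
  obtain ⟨a, ha⟩ := hprec.prec hcauchy
  refine ⟨a, fun x => ?_⟩
  obtain ⟨n, y', hy'⟩ := exists_pow_mul_eq_coe hϖ x
  have hx : x = ((ϖ : F)⁻¹) ^ n * y' := by
    rw [← hy', inv_pow, inv_mul_cancel_left₀ (pow_ne_zero _ hϖ0)]
  have happ : Approximates ψ θ ϖ (n + 1) (f (n + 1)) := (approxSeq hϖ hψ1 hψ2 hθ (n + 1)).2
  have h1 : θ x = ψ (f (n + 1) * x) := by
    have := happ (ϖ * y')
    have e : ((ϖ : F)⁻¹) ^ (n + 1) * ((ϖ * y' : 𝒪[F]) : F) = x := by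
      rw [Subring.coe_mul, pow_succ, mul_assoc, inv_mul_cancel_left₀ hϖ0, hx]
    rwa [e] at this
  have h2 : f (n + 1) - a ∈ 𝓂[F] ^ (n + 1) := by
    have := ha (n + 1)
    simp only [SModEq.sub_mem, smul_eq_mul, Ideal.mul_top] at this
    exact this
  rw [hϖ.maximalIdeal_eq, Ideal.span_singleton_pow, Ideal.mem_span_singleton] at h2
  obtain ⟨w, hw⟩ := h2
  have hϖn : (ϖ : F) ^ n * ((ϖ : F)⁻¹) ^ n = 1 := by
    rw [inv_pow, mul_inv_cancel₀ (pow_ne_zero _ hϖ0)]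
  have h3 : (a : F) * x = f (n + 1) * x + ((-(ϖ * w * y') : 𝒪[F]) : F) := by
    have hw' := congrArg Subtype.val hw
    push_cast at hw' ⊢
    rw [hx]
    linear_combination (-(((ϖ : F)⁻¹) ^ n * (y' : F))) * hw' + (-((ϖ : F) * w * y')) * hϖn
  rw [h3, AddChar.map_add_eq_mul, ← h1, hψ1 _ ?_, mul_one]
  exact neg_mem (Ideal.mul_mem_right _ _ (Ideal.mul_mem_right _ _
    (mem_maximalIdeal_of_irreducible hϖ)))

/-! ### Additive duality -/

/-- **Additive duality for a non-archimedean local field** (Bushnell–Henniart 2006, §1.7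
Proposition; Bump 1997, Exercise 3.1.1 (d)–(e); Tate 1950, Lemma 2.2.1): if `ψ` is a
non-trivial continuous additive character of `F`, every continuous additive character `θ`
of `F` is `x ↦ ψ(a x)` for some `a ∈ F`, i.e. `θ = ψ.mulShift a`. [cite: Bump1997, Exercise 3.1.1 (d) (PDF p. 266)] [cite: CasselsFrohlichANT1967, Ch. XV (Tate's thesis), Lemma 2.2.1 (PDF p. 335)] [cite: BushnellHenniart2006, §1.7 Proposition] -/
theorem exists_eq_mulShift {ψ θ : AddChar F Circle} (hψ : ψ.IsContinuousNontrivial)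
    (hθ : Continuous θ) : ∃ a : F, θ = ψ.mulShift a := by
  obtain ⟨ϖ, hϖ⟩ := IsDiscreteValuationRing.exists_irreducible 𝒪[F]
  obtain ⟨t, ht, hψ1, hψ2⟩ := exists_mulShift_level_one hϖ hψ
  obtain ⟨s, hs, hθ1⟩ := exists_mulShift_apply_integer_eq_one hϖ hθ
  obtain ⟨a', ha'⟩ := exists_forall_apply_eq_of_apply_integer_eq_one hϖ
    (ψ := ψ.mulShift t) (θ := θ.mulShift s) hψ1 hψ2 hθ1
  refine ⟨t * a' * s⁻¹, DFunLike.ext _ _ fun x => ?_⟩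
  have := ha' (s⁻¹ * x)
  simp only [AddChar.mulShift_apply] at this ⊢
  rw [mul_inv_cancel_left₀ hs] at this
  rw [this]
  congr 1
  ring

omit [ValuativeRel F] [TopologicalSpace F] [IsNonarchimedeanLocalField F] in
/-- **Additive duality, uniqueness** (Bushnell–Henniart 2006, §1.7 Proposition; Bump 1997,
Exercise 3.1.1 (d)): for `ψ` non-trivial, `a ↦ ψ(a ·)` is injective. [cite: Bump1997, Exercise 3.1.1 (d) (PDF p. 266)] -/
theorem mulShift_injective {ψ : AddChar F Circle} (hψ : ψ ≠ 0) :
    Function.Injective (ψ.mulShift : F → AddChar F Circle) := by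
  intro a b hab
  by_contra hne
  obtain ⟨x₀, hx₀⟩ := AddChar.ne_zero_iff.1 hψ
  apply hx₀
  have := DFunLike.congr_fun hab ((a - b)⁻¹ * x₀)
  simp only [AddChar.mulShift_apply] at this
  have e : a * ((a - b)⁻¹ * x₀) = b * ((a - b)⁻¹ * x₀) + x₀ := by
    field_simp [sub_ne_zero.2 hne]
    ring
  rw [e, AddChar.map_add_eq_mul] at this
  exact mul_eq_left.1 this

/-- **Additive duality for non-trivial characters**: if `ψ` and `ψ'` are non-trivial continuous
additive characters of `F`, then `ψ' = ψ(a ·)` for a (unique) `a ∈ Fˣ`.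
(Bushnell–Henniart 2006, §1.7 Proposition; Bump 1997, Exercise 3.1.1 (d).) [cite: Bump1997, Exercise 3.1.1 (d) (PDF p. 266)] -/
theorem exists_ne_zero_eq_mulShift {ψ ψ' : AddChar F Circle} (hψ : ψ.IsContinuousNontrivial)
    (hψ' : ψ'.IsContinuousNontrivial) : ∃ a : F, a ≠ 0 ∧ ψ' = ψ.mulShift a := by
  obtain ⟨a, rfl⟩ := exists_eq_mulShift hψ hψ'.1
  refine ⟨a, ?_, rfl⟩
  rintro rfl
  exact hψ'.2 (by rw [AddChar.mulShift_zero]; rfl)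

end AddCharDuality

end Literature.NumberTheory.Automorphic
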